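import Literature.MathematicalPhysics.QuantumFieldTheory.ContinuumLimitsProofs
import Literature.MathematicalPhysics.QuantumFieldTheory.LatticeGaugeProofs
import Literature.MathematicalPhysics.QuantumLattice.SU2HaarSmallBall
import Mathlib.Analysis.Convex.Integral
import Mathlib.Analysis.SpecialFunctions.Log.Basic
import HarnessLib

/-!
# Chatterjee's key estimate (Lemma 5.5) for the unitary-gauge `SU(2)` Yang–Mills–Higgs measure

S. Chatterjee, *A scaling limit of `SU(2)` lattice Yang–Mills–Higgs theory*, Probab. Math.
Phys. **7** (2026) 339, arXiv:2401.10507 [Chatterjee2026YMHiggs], §5.3, **Lemma 5.5** ("the key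
estimate for proving Theorem 3.2"): for the unitary-gauge-fixed `SU(2)` theory on the torus,
`E‖I − V_e‖² ≤ C/(α⁴g²) + C log α/α²` with `C` depending only on `d` — in particular uniformly
in the volume. This file PROVES it, with explicit constants, for the tree's torus measure
`su2HiggsMeasure L g α` of `ContinuumLimits.lean` (constructive-qft.S19; Chatterjee's action with
`g_C = √2 g`, `α_C = α`, see the audit in that file's module docstring), as

  `integral_su2Deficit_le_keyEstimate`:
  `E[2 − Re tr U_{(x,i)}] ≤ 16 d²/(g² α⁴) + (d + 2 d log (16 α⁴))/α²`  for `α ≥ 2`,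

every `d`, `L ≥ 1`, real `g` (including the junk `β = 0` at `g = 0`) and edge `(x, i)`; here
`2 − Re tr U = ‖I − U‖²_F / 2` (`su2Deficit_eq_norm_sub_sq` identifies it with the squared
quaternion distance `‖1 − q_U‖²` on `S³ ≅ SU(2)`). This is DAG node N3 of the proof plan for
`ContinuumLimits.chatterjee_su2_higgs` recorded by the literature audit; no named facts are
introduced (all `def`s carry bodies, all statements are proved).

## Contents and proof (as in print, §5.3)

* `su2Deficit`, `su2HiggsH`: the trace deficit `t(U) = 2 − Re tr U ∈ [0, 4]` and the Hamiltonian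
  `H = (2g²)⁻¹ ∑ₚ t(U_p) + (α²/2) ∑ₑ t(U_e)` (Chatterjee's `H` with `‖I − U‖² = 2t`, `g_C² = 2g²`);
  `su2HiggsMeasure_eq_gibbs`: `su2HiggsMeasure L g α = Z⁻¹ • e^{−H} ∏ₑ dU_e` (Lemma 5.4/§5.3 form
  of the tree's `su2HiggsWeight`, whose exponent is `α²|E| − H`).
* `lintegral_exp_su2HiggsH`: the Gibbs identity `E[e^{H}] = 1/Z`; `integral_su2HiggsH_le_log`:
  `E[H] ≤ log (1/Z)` by Jensen for the concave `log` on `[1, ∞)` (Mathlib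
  `ConcaveOn.le_map_integral`; the paper uses the equivalent layer-cake bound
  `P(H ≥ t) ≤ e^{−t} E e^{H}`).
* `su2HiggsMeasure_map_torusConfigShift`, `integral_su2Deficit_edge_eq`: translation invariance
  ("by symmetry (due to periodic boundary), `E‖V_e − I‖²` is the same for all `e`" — here for
  all base points at fixed direction, which is all that is needed), hence
  `card_mul_integral_su2Deficit_le`: `(α²/2) |Λ| E[t(U_{(x,i)})] ≤ E[H] ≤ log(1/Z)`.
* `su2Deficit_plaquetteHolonomy_le`: if all edge deficits are `≤ η` then every plaquette deficit
  is `≤ 16η` (subadditivity `‖1 − pq‖ ≤ ‖1 − p‖ + ‖1 − q‖` of the quaternion distance, `su2Quat`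
  multiplicative); `le_su2HaarPi_goodSet`: `π(Σ') ≥ (η²/16)^{|E|}` for the product set
  `Σ' = {t(U_e) ≤ η ∀ e}` (`SU2HaarSmallBall.le_haarProbability_su2_two_sub_trace_le`, in place of
  the paper's `(C₁α)^{−C₂Lᵈ}` via `S³` volumes); `le_su2GibbsZ`, `log_inv_su2GibbsZ_le`:
  `Z ≥ e^{−sup_{Σ'}H} π(Σ')`, `log(1/Z) ≤ (2g²)⁻¹16η|P| + (α²/2)η|E| + |E| log(16/η²)`.
* Assembly with `η = α⁻²` (`α ≥ 2` ⇔ `η ≤ 1/4`), `|E| = d|Λ|`, `|P| ≤ d²|Λ|`.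

Mathlib: `Measure.pi_pi`, `withDensity_mul`, `withDensity_smul`, `lintegral_withDensity_eq_lintegral_mul`,
`ConcaveOn.le_map_integral`, `strictConcaveOn_log_Ioi`, `Integrable.of_mem_Icc`,
`measurePreserving_arrowCongr'`; tree: `isProbabilityMeasure_su2HiggsMeasure_holds`
(`ContinuumLimitsProofs`), `torusConfigShift`, `withDensity_map_of_measurableEquiv`,
`measurable_wilsonAction` (`LatticeGaugeProofs`), `SU2Haar`/`SU2HaarSmallBall`.
-/

noncomputable section

open MeasureTheory Filter Topology
open scoped ENNReal Quaternion
open Literature.MathematicalPhysics.QuantumLattice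

namespace Literature.MathematicalPhysics.QuantumFieldTheory

attribute [local instance] Literature.MathematicalPhysics.QuantumLattice.secondCountableTopology_su2

variable {d : ℕ}

/-! ### The trace deficit and the Hamiltonian -/

/-- The trace deficit `t(U) = 2 − Re tr U ∈ [0, 4]` of `U ∈ SU(2)`; on `SU(2)`,
`‖1 − U‖²_F = 2 t(U)` (Chatterjee (5.2): `‖I − U‖² = 4 − 2 Re Tr U`). [cite: Chatterjee2026YMHiggs, §5.3 (5.2)] -/
def su2Deficit (U : SU2) : ℝ := 2 - ((U : Matrix (Fin 2) (Fin 2) ℂ).trace).re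

/-- `U ↦ t(U)` is continuous. [folklore] -/
theorem continuous_su2Deficit : Continuous su2Deficit :=
  continuous_const.sub (Complex.continuous_re.comp (continuous_subtype_val.matrix_trace))

/-- Entries of a unitary matrix have norm at most one, so `|Re tr U| ≤ 2` on `SU(2)` and the
deficit lies in `[0, 4]`: lower bound. [folklore] -/
theorem su2Deficit_nonneg (U : SU2) : 0 ≤ su2Deficit U := by
  have hU : (U : Matrix (Fin 2) (Fin 2) ℂ) ∈ Matrix.unitaryGroup (Fin 2) ℂ :=
    (Matrix.mem_specialUnitaryGroup_iff.1 U.2).1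
  have h0 := entry_norm_bound_of_unitary hU 0 0
  have h1 := entry_norm_bound_of_unitary hU 1 1
  have hre0 := (Complex.abs_re_le_norm ((U : Matrix (Fin 2) (Fin 2) ℂ) 0 0)).trans h0
  have hre1 := (Complex.abs_re_le_norm ((U : Matrix (Fin 2) (Fin 2) ℂ) 1 1)).trans h1
  unfold su2Deficit
  rw [Matrix.trace_fin_two, Complex.add_re]
  have := (abs_le.1 hre0).2
  have := (abs_le.1 hre1).2
  linarith

/-- Upper bound `t(U) ≤ 4`. [folklore] -/
theorem su2Deficit_le_four (U : SU2) : su2Deficit U ≤ 4 := by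
  have hU : (U : Matrix (Fin 2) (Fin 2) ℂ) ∈ Matrix.unitaryGroup (Fin 2) ℂ :=
    (Matrix.mem_specialUnitaryGroup_iff.1 U.2).1
  have h0 := entry_norm_bound_of_unitary hU 0 0
  have h1 := entry_norm_bound_of_unitary hU 1 1
  have hre0 := (Complex.abs_re_le_norm ((U : Matrix (Fin 2) (Fin 2) ℂ) 0 0)).trans h0
  have hre1 := (Complex.abs_re_le_norm ((U : Matrix (Fin 2) (Fin 2) ℂ) 1 1)).trans h1
  unfold su2Deficit
  rw [Matrix.trace_fin_two, Complex.add_re]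
  have := (abs_le.1 hre0).1
  have := (abs_le.1 hre1).1
  linarith

variable {L : ℕ} [NeZero L]

/-- Chatterjee's Hamiltonian of the unitary-gauge `SU(2)` Yang–Mills–Higgs theory in the tree's
normalisation: `H(U) = (2g²)⁻¹ ∑ₚ t(U_p) + (α²/2) ∑ₑ t(U_e)` with `t = 2 − Re tr`, so that
`su2HiggsWeight` has density `∝ e^{−H}` against product Haar measure (Chatterjee §5.3:
`H(U) = (2g_C²)⁻¹ ∑ₚ ‖I − U_p‖² + (α²/4) ∑ₑ ‖I − U_e‖²` with `‖I − U‖² = 2t(U)`, `g_C² = 2g²`).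
[cite: Chatterjee2026YMHiggs, §5.3 (the Hamiltonian H)] -/
def su2HiggsH (g α : ℝ) (U : GaugeConfig d L SU2) : ℝ :=
  (2 * g ^ 2)⁻¹ * ∑ p : Plaquette d L, su2Deficit (plaquetteHolonomy U p.1 p.2.1.1 p.2.1.2) +
    α ^ 2 / 2 * ∑ e : Edge d L, su2Deficit (U e)

/-- `H ≥ 0`. [folklore] -/
theorem su2HiggsH_nonneg (g α : ℝ) (U : GaugeConfig d L SU2) : 0 ≤ su2HiggsH g α U :=
  add_nonneg
    (mul_nonneg (inv_nonneg.2 (by positivity))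
      (Finset.sum_nonneg fun p _ => su2Deficit_nonneg _))
    (mul_nonneg (by positivity) (Finset.sum_nonneg fun e _ => su2Deficit_nonneg _))

/-- `H` is continuous on the compact configuration space. [folklore] -/
theorem continuous_su2HiggsH (g α : ℝ) : Continuous (su2HiggsH (d := d) (L := L) g α) := by
  unfold su2HiggsH
  refine (continuous_const.mul (continuous_finsetSum _ fun p _ => ?_)).add
    (continuous_const.mul (continuous_finsetSum _ fun e _ =>
      continuous_su2Deficit.comp (continuous_apply e)))
  refine continuous_su2Deficit.comp ?_
  unfold plaquetteHolonomy
  fun_prop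

/-- `H` is measurable (product σ-algebra = Borel σ-algebra, `SU(2)` second countable). [folklore] -/
theorem measurable_su2HiggsH (g α : ℝ) : Measurable (su2HiggsH (d := d) (L := L) g α) :=
  (continuous_su2HiggsH g α).measurable

/-- The Gibbs density `e^{−H}` is measurable. [folklore] -/
theorem measurable_exp_neg_su2HiggsH (g α : ℝ) :
    Measurable fun U : GaugeConfig d L SU2 => ENNReal.ofReal (Real.exp (-su2HiggsH g α U)) :=
  ENNReal.measurable_ofReal.comp (Real.measurable_exp.comp (measurable_su2HiggsH g α).neg)

/-- `e^{H}` is measurable. [folklore] -/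
theorem measurable_exp_su2HiggsH (g α : ℝ) :
    Measurable fun U : GaugeConfig d L SU2 => ENNReal.ofReal (Real.exp (su2HiggsH g α U)) :=
  ENNReal.measurable_ofReal.comp (Real.measurable_exp.comp (measurable_su2HiggsH g α))

/-- `H` is bounded: `H ≤ (2g²)⁻¹ · 4|P| + (α²/2) · 4|E|`. [folklore] -/
theorem su2HiggsH_le (g α : ℝ) (U : GaugeConfig d L SU2) :
    su2HiggsH g α U ≤ (2 * g ^ 2)⁻¹ * (4 * Fintype.card (Plaquette d L)) +
      α ^ 2 / 2 * (4 * Fintype.card (Edge d L)) := by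
  unfold su2HiggsH
  gcongr
  · calc ∑ p : Plaquette d L, su2Deficit (plaquetteHolonomy U p.1 p.2.1.1 p.2.1.2)
        ≤ ∑ _p : Plaquette d L, (4 : ℝ) := Finset.sum_le_sum fun p _ => su2Deficit_le_four _
      _ = 4 * Fintype.card (Plaquette d L) := by simp [mul_comm]
  · calc ∑ e : Edge d L, su2Deficit (U e)
        ≤ ∑ _e : Edge d L, (4 : ℝ) := Finset.sum_le_sum fun e _ => su2Deficit_le_four _
      _ = 4 * Fintype.card (Edge d L) := by simp [mul_comm]

/-! ### The Gibbs measure of `H` and its identification with `su2HiggsMeasure` -/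

/-- Product Haar measure on `SU(2)`-configurations of the torus. [folklore] -/
def su2HaarPi (d L : ℕ) [NeZero L] : Measure (GaugeConfig d L SU2) :=
  Measure.pi fun _ : Edge d L => haarProbability SU2

/-- Product Haar measure is a probability measure (instance). [folklore] -/
instance isProbabilityMeasure_su2HaarPi : IsProbabilityMeasure (su2HaarPi d L) := by
  unfold su2HaarPi; infer_instance

/-- The Gibbs weight `e^{−H} ∏ₑ dU_e`. [folklore] -/
def su2GibbsWeight (g α : ℝ) : Measure (GaugeConfig d L SU2) :=
  (su2HaarPi d L).withDensity fun U => ENNReal.ofReal (Real.exp (-su2HiggsH g α U))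

/-- The partition function `Z = ∫ e^{−H} ∏ₑ dU_e`. [folklore] -/
def su2GibbsZ (d L : ℕ) [NeZero L] (g α : ℝ) : ℝ≥0∞ := su2GibbsWeight (d := d) (L := L) g α Set.univ

/-- `Z` as a lower Lebesgue integral. [folklore] -/
theorem su2GibbsZ_eq_lintegral (g α : ℝ) :
    su2GibbsZ d L g α = ∫⁻ U, ENNReal.ofReal (Real.exp (-su2HiggsH g α U)) ∂su2HaarPi d L := by
  rw [su2GibbsZ, su2GibbsWeight, withDensity_apply _ MeasurableSet.univ, Measure.restrict_univ]

/-- `Z ≤ 1` (since `H ≥ 0` and product Haar is a probability measure). [folklore] -/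
theorem su2GibbsZ_le_one (g α : ℝ) : su2GibbsZ d L g α ≤ 1 := by
  rw [su2GibbsZ_eq_lintegral]
  calc ∫⁻ U, ENNReal.ofReal (Real.exp (-su2HiggsH g α U)) ∂su2HaarPi d L
      ≤ ∫⁻ _U, 1 ∂su2HaarPi d L := lintegral_mono fun U => by
        rw [← ENNReal.ofReal_one]
        exact ENNReal.ofReal_le_ofReal
          (Real.exp_le_one_iff.2 (by linarith [su2HiggsH_nonneg g α U]))
    _ = 1 := by simp

/-- `Z ≠ ⊤`. [folklore] -/
theorem su2GibbsZ_ne_top (g α : ℝ) : su2GibbsZ d L g α ≠ ∞ :=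
  ne_top_of_le_ne_top ENNReal.one_ne_top (su2GibbsZ_le_one g α)

/-- Crude positivity: `Z ≥ e^{−sup H} > 0`. [folklore] -/
theorem exp_neg_le_su2GibbsZ (g α : ℝ) :
    ENNReal.ofReal (Real.exp (-((2 * g ^ 2)⁻¹ * (4 * Fintype.card (Plaquette d L)) +
      α ^ 2 / 2 * (4 * Fintype.card (Edge d L))))) ≤ su2GibbsZ d L g α := by
  rw [su2GibbsZ_eq_lintegral]
  calc _ = ∫⁻ _U, ENNReal.ofReal (Real.exp (-((2 * g ^ 2)⁻¹ * (4 * Fintype.card (Plaquette d L)) +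
      α ^ 2 / 2 * (4 * Fintype.card (Edge d L))))) ∂su2HaarPi d L := by
        rw [lintegral_const, measure_univ, mul_one]
    _ ≤ _ := lintegral_mono fun U => ENNReal.ofReal_le_ofReal
        (Real.exp_le_exp.2 (neg_le_neg (su2HiggsH_le g α U)))

/-- `Z ≠ 0`. [folklore] -/
theorem su2GibbsZ_ne_zero (g α : ℝ) : su2GibbsZ d L g α ≠ 0 :=
  (lt_of_lt_of_le (ENNReal.ofReal_pos.2 (Real.exp_pos _)) (exp_neg_le_su2GibbsZ g α)).ne'

/-- The exponent of `su2HiggsWeight` is `α²|E| − H`: with `ρ` the fundamental representation,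
`−(2g²)⁻¹ S_W(U) + (α²/2) ∑ₑ Re tr U_e = α² |E| − H(U)`. [folklore] -/
theorem neg_wilsonAction_add_edge_eq (g α : ℝ) (U : GaugeConfig d L SU2) :
    -(2 * g ^ 2)⁻¹ * wilsonAction (fundamentalRep (Fin 2)) U +
        α ^ 2 / 2 * ∑ e : Edge d L, ((fundamentalRep (Fin 2) (U e)).trace).re =
      α ^ 2 * Fintype.card (Edge d L) - su2HiggsH g α U := by
  have hW : wilsonAction (fundamentalRep (Fin 2)) U =
      ∑ p : Plaquette d L, su2Deficit (plaquetteHolonomy U p.1 p.2.1.1 p.2.1.2) := by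
    unfold wilsonAction su2Deficit
    refine Finset.sum_congr rfl fun p _ => ?_
    simp [fundamentalRep_apply]
  have hE : ∑ e : Edge d L, ((fundamentalRep (Fin 2) (U e)).trace).re =
      2 * Fintype.card (Edge d L) - ∑ e : Edge d L, su2Deficit (U e) := by
    simp only [fundamentalRep_apply, su2Deficit, Finset.sum_sub_distrib, Finset.sum_const,
      Finset.card_univ, nsmul_eq_mul]
    ring
  rw [hW, hE, su2HiggsH]
  ring

/-- **`su2HiggsWeight` is `e^{α²|E|}` times the Gibbs weight `e^{−H} ∏ dU_e`.** [folklore] -/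
theorem su2HiggsWeight_eq_smul_su2GibbsWeight (g α : ℝ) :
    su2HiggsWeight (d := d) L g α =
      ENNReal.ofReal (Real.exp (α ^ 2 * Fintype.card (Edge d L))) • su2GibbsWeight g α := by
  have hρ : Continuous (fundamentalRep (Fin 2)) := continuous_fundamentalRep (Fin 2)
  have hm1 : Measurable fun U : GaugeConfig d L SU2 =>
      ENNReal.ofReal (Real.exp (-(2 * g ^ 2)⁻¹ * wilsonAction (fundamentalRep (Fin 2)) U)) :=
    ENNReal.measurable_ofReal.comp (Real.measurable_exp.comp
      (measurable_const.mul (measurable_wilsonAction (fundamentalRep (Fin 2)) hρ)))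
  have hm2 : Measurable fun U : GaugeConfig d L SU2 =>
      ENNReal.ofReal (Real.exp (α ^ 2 / 2 * ∑ e : Edge d L, ((fundamentalRep (Fin 2) (U e)).trace).re)) := by
    refine ENNReal.measurable_ofReal.comp (Real.measurable_exp.comp (measurable_const.mul ?_))
    refine Finset.measurable_sum _ fun e _ => ?_
    exact (continuous_trace_re (fundamentalRep (Fin 2)) hρ).measurable.comp (measurable_pi_apply e)
  unfold su2HiggsWeight wilsonWeight su2GibbsWeight su2HaarPi
  rw [← withDensity_mul _ hm1 hm2, ← withDensity_smul _ (measurable_exp_neg_su2HiggsH g α)]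
  congr 1
  funext U
  simp only [Pi.mul_apply, Pi.smul_apply, smul_eq_mul]
  rw [← ENNReal.ofReal_mul (Real.exp_pos _).le, ← ENNReal.ofReal_mul (Real.exp_pos _).le,
    ← Real.exp_add, ← Real.exp_add, neg_wilsonAction_add_edge_eq, sub_eq_add_neg]

/-- **The unitary-gauge YMH measure is the Gibbs measure of `H`**:
`su2HiggsMeasure L g α = Z⁻¹ • e^{−H} ∏ₑ dU_e`. (Chatterjee Lemma 5.4 / §5.3: "the probability
density of `V` is proportional to `e^{−H(U)}`".) [cite: Chatterjee2026YMHiggs, Lemma 5.4 and §5.3] -/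
theorem su2HiggsMeasure_eq_gibbs (g α : ℝ) :
    su2HiggsMeasure (d := d) L g α = (su2GibbsZ d L g α)⁻¹ • su2GibbsWeight g α := by
  set C : ℝ≥0∞ := ENNReal.ofReal (Real.exp (α ^ 2 * Fintype.card (Edge d L))) with hC
  have hC0 : C ≠ 0 := (ENNReal.ofReal_pos.2 (Real.exp_pos _)).ne'
  have hCt : C ≠ ∞ := ENNReal.ofReal_ne_top
  unfold su2HiggsMeasure
  rw [su2HiggsWeight_eq_smul_su2GibbsWeight, Measure.smul_apply, smul_eq_mul, smul_smul]
  congr 1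
  rw [← hC, show C * su2GibbsWeight g α Set.univ = C * su2GibbsZ d L g α from rfl,
    ENNReal.mul_inv (Or.inl hC0) (Or.inl hCt), mul_comm C⁻¹, mul_assoc,
    ENNReal.inv_mul_cancel hC0 hCt, mul_one]

/-- Expectations under the YMH measure as Gibbs averages:
`∫⁻ F dμ = Z⁻¹ ∫⁻ F e^{−H} ∏ dU_e`. [folklore] -/
theorem lintegral_su2HiggsMeasure (g α : ℝ) {F : GaugeConfig d L SU2 → ℝ≥0∞} (hF : Measurable F) :
    ∫⁻ U, F U ∂su2HiggsMeasure (d := d) L g α =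
      (su2GibbsZ d L g α)⁻¹ *
        ∫⁻ U, F U * ENNReal.ofReal (Real.exp (-su2HiggsH g α U)) ∂su2HaarPi d L := by
  rw [su2HiggsMeasure_eq_gibbs, lintegral_smul_measure, su2GibbsWeight,
    lintegral_withDensity_eq_lintegral_mul _ (measurable_exp_neg_su2HiggsH g α) hF, smul_eq_mul]
  congr 1
  exact lintegral_congr fun U => by simp [mul_comm]

/-- **The Gibbs identity** `E[e^{H}] = 1/Z`. (Chatterjee, proof of Lemma 5.5:
"`1/∫ p(U) ∏ dU_e = E(p(V)⁻¹)`".) [cite: Chatterjee2026YMHiggs, proof of Lemma 5.5] -/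
theorem lintegral_exp_su2HiggsH (g α : ℝ) :
    ∫⁻ U, ENNReal.ofReal (Real.exp (su2HiggsH g α U)) ∂su2HiggsMeasure (d := d) L g α =
      (su2GibbsZ d L g α)⁻¹ := by
  rw [lintegral_su2HiggsMeasure g α (measurable_exp_su2HiggsH g α)]
  have h1 : ∀ U : GaugeConfig d L SU2, ENNReal.ofReal (Real.exp (su2HiggsH g α U)) *
      ENNReal.ofReal (Real.exp (-su2HiggsH g α U)) = 1 := fun U => by
    rw [← ENNReal.ofReal_mul (Real.exp_pos _).le, ← Real.exp_add, add_neg_cancel, Real.exp_zero,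
      ENNReal.ofReal_one]
  simp only [h1, lintegral_const, measure_univ, mul_one]

/-- Bochner form of the Gibbs identity: `∫ e^{H} dμ = (1/Z).toReal`. [folklore] -/
theorem integral_exp_su2HiggsH (g α : ℝ) :
    ∫ U, Real.exp (su2HiggsH g α U) ∂su2HiggsMeasure (d := d) L g α =
      ((su2GibbsZ d L g α)⁻¹).toReal := by
  rw [integral_eq_lintegral_of_nonneg_ae (ae_of_all _ fun U => (Real.exp_pos _).le)
    ((Real.measurable_exp.comp (measurable_su2HiggsH g α)).aestronglyMeasurable),
    lintegral_exp_su2HiggsH]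

/-- **Jensen step**: `E[H] ≤ log E[e^{H}] = log (1/Z)`. (Chatterjee bounds `E[H]` by a
layer-cake integral of `P(H ≥ t) ≤ e^{−t} E e^{H}`; Jensen gives the same bound without the
additive constant.) [cite: Chatterjee2026YMHiggs, proof of Lemma 5.5] -/
theorem integral_su2HiggsH_le_log (g α : ℝ) :
    ∫ U, su2HiggsH g α U ∂su2HiggsMeasure (d := d) L g α ≤
      Real.log (((su2GibbsZ d L g α)⁻¹).toReal) := by
  haveI : IsProbabilityMeasure (su2HiggsMeasure (d := d) L g α) :=
    isProbabilityMeasure_su2HiggsMeasure_holds (d := d) L g α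
  set μ := su2HiggsMeasure (d := d) L g α with hμ
  have hHm := measurable_su2HiggsH (d := d) (L := L) g α
  have hB := su2HiggsH_le (d := d) (L := L) g α
  set B : ℝ := (2 * g ^ 2)⁻¹ * (4 * Fintype.card (Plaquette d L)) +
      α ^ 2 / 2 * (4 * Fintype.card (Edge d L)) with hBdef
  have hfi : Integrable (fun U => Real.exp (su2HiggsH g α U)) μ := by
    refine Integrable.of_mem_Icc 1 (Real.exp B) (Real.measurable_exp.comp hHm).aemeasurable
      (ae_of_all _ fun U => ⟨?_, ?_⟩)
    · exact Real.one_le_exp (su2HiggsH_nonneg g α U)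
    · exact Real.exp_le_exp.2 (hB U)
  have hgi : Integrable (Real.log ∘ fun U : GaugeConfig d L SU2 => Real.exp (su2HiggsH g α U)) μ := by
    have : (Real.log ∘ fun U : GaugeConfig d L SU2 => Real.exp (su2HiggsH g α U)) =
        su2HiggsH g α := by
      funext U; simp
    rw [this]
    exact Integrable.of_mem_Icc 0 B hHm.aemeasurable
      (ae_of_all _ fun U => ⟨su2HiggsH_nonneg g α U, hB U⟩)
  have hconc : ConcaveOn ℝ (Set.Ici (1 : ℝ)) Real.log :=
    strictConcaveOn_log_Ioi.concaveOn.subset (Set.Ici_subset_Ioi.2 one_pos) (convex_Ici 1)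
  have hcont : ContinuousOn Real.log (Set.Ici (1 : ℝ)) :=
    Real.continuousOn_log.mono fun x hx => ne_of_gt (lt_of_lt_of_le one_pos hx)
  have hJ := hconc.le_map_integral hcont isClosed_Ici
    (ae_of_all _ fun U => Real.one_le_exp (su2HiggsH_nonneg g α U)) hfi hgi
  simp only [Real.log_exp] at hJ
  rwa [integral_exp_su2HiggsH] at hJ

/-! ### Translation invariance -/

/-- `H` is invariant under torus translations. [folklore] -/
theorem su2HiggsH_torusConfigShift (g α : ℝ) (v : Site d L) (U : GaugeConfig d L SU2) :
    su2HiggsH g α (torusConfigShift v U) = su2HiggsH g α U := by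
  have hP : ∑ p : Plaquette d L,
      su2Deficit (plaquetteHolonomy (torusConfigShift v U) p.1 p.2.1.1 p.2.1.2) =
      ∑ p : Plaquette d L, su2Deficit (plaquetteHolonomy U p.1 p.2.1.1 p.2.1.2) := by
    simp only [plaquetteHolonomy_torusConfigShift]
    exact Fintype.sum_equiv ((Equiv.subRight v).prodCongr (Equiv.refl _)) _ _ fun p => rfl
  have hE : ∑ e : Edge d L, su2Deficit (torusConfigShift v U e) =
      ∑ e : Edge d L, su2Deficit (U e) := by
    simp only [torusConfigShift_apply]
    exact Fintype.sum_equiv ((Equiv.subRight v).prodCongr (Equiv.refl _)) _ _ fun e => rfl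
  unfold su2HiggsH
  rw [hP, hE]

/-- Product Haar measure is invariant under torus translations (a permutation of the factors).
[folklore] -/
theorem su2HaarPi_map_torusConfigShift (v : Site d L) :
    (su2HaarPi d L).map (torusConfigShift v) = su2HaarPi d L :=
  (measurePreserving_arrowCongr' (fun _ : Edge d L => haarProbability SU2)
    (fun _ : Edge d L => haarProbability SU2) (torusEdgeShift v) (MeasurableEquiv.refl SU2)
    fun _ => MeasurePreserving.id _).map_eq

/-- The Gibbs weight is invariant under torus translations. [folklore] -/
theorem su2GibbsWeight_map_torusConfigShift (g α : ℝ) (v : Site d L) :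
    (su2GibbsWeight (d := d) (L := L) g α).map (torusConfigShift v) = su2GibbsWeight g α := by
  unfold su2GibbsWeight
  rw [withDensity_map_of_measurableEquiv _ _ _ (su2HaarPi_map_torusConfigShift v)]
  intro U
  rw [su2HiggsH_torusConfigShift]

/-- **The unitary-gauge YMH measure is translation invariant** ("by symmetry (due to periodic
boundary)", Chatterjee, proof of Lemma 5.5). [cite: Chatterjee2026YMHiggs, proof of Lemma 5.5] -/
theorem su2HiggsMeasure_map_torusConfigShift (g α : ℝ) (v : Site d L) :
    (su2HiggsMeasure (d := d) L g α).map (torusConfigShift v) = su2HiggsMeasure L g α := by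
  rw [su2HiggsMeasure_eq_gibbs, Measure.map_smul, su2GibbsWeight_map_torusConfigShift]

/-- Single-edge expectations do not depend on the base point of the edge. [folklore] -/
theorem lintegral_edge_eq (g α : ℝ) (F : SU2 → ℝ≥0∞) (hF : Measurable F) (i : Fin d)
    (x y : Site d L) :
    ∫⁻ U, F (U (x, i)) ∂su2HiggsMeasure (d := d) L g α =
      ∫⁻ U, F (U (y, i)) ∂su2HiggsMeasure (d := d) L g α := by
  have hmeas : ∀ z : Site d L, Measurable fun U : GaugeConfig d L SU2 => F (U (z, i)) :=
    fun z => hF.comp (measurable_pi_apply _)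
  calc ∫⁻ U, F (U (x, i)) ∂su2HiggsMeasure (d := d) L g α
      = ∫⁻ U, F (U (x, i)) ∂(su2HiggsMeasure (d := d) L g α).map (torusConfigShift (x - y)) := by
        rw [su2HiggsMeasure_map_torusConfigShift]
    _ = ∫⁻ U, F ((torusConfigShift (x - y) U) (x, i)) ∂su2HiggsMeasure (d := d) L g α :=
        lintegral_map (hmeas x) (torusConfigShift (x - y)).measurable
    _ = ∫⁻ U, F (U (y, i)) ∂su2HiggsMeasure (d := d) L g α := by
        congr 1; funext U
        rw [torusConfigShift_apply, sub_sub_cancel]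

/-- Bochner form of `lintegral_edge_eq` for the trace deficit. [folklore] -/
theorem integral_su2Deficit_edge_eq (g α : ℝ) (i : Fin d) (x y : Site d L) :
    ∫ U, su2Deficit (U (x, i)) ∂su2HiggsMeasure (d := d) L g α =
      ∫ U, su2Deficit (U (y, i)) ∂su2HiggsMeasure (d := d) L g α := by
  have hmeas : ∀ z : Site d L, Measurable fun U : GaugeConfig d L SU2 => su2Deficit (U (z, i)) :=
    fun z => continuous_su2Deficit.measurable.comp (measurable_pi_apply _)
  rw [integral_eq_lintegral_of_nonneg_ae (ae_of_all _ fun U => su2Deficit_nonneg _)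
      (hmeas x).aestronglyMeasurable,
    integral_eq_lintegral_of_nonneg_ae (ae_of_all _ fun U => su2Deficit_nonneg _)
      (hmeas y).aestronglyMeasurable,
    lintegral_edge_eq g α (fun V => ENNReal.ofReal (su2Deficit V))
      (ENNReal.measurable_ofReal.comp continuous_su2Deficit.measurable) i x y]

/-- The Higgs term dominates the deficit of the edges in one direction:
`(α²/2) ∑ₓ t(U_{(x,i)}) ≤ H(U)`. [folklore] -/
theorem sum_su2Deficit_dir_le_su2HiggsH (g α : ℝ) (i : Fin d) (U : GaugeConfig d L SU2) :
    α ^ 2 / 2 * ∑ x : Site d L, su2Deficit (U (x, i)) ≤ su2HiggsH g α U := by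
  unfold su2HiggsH
  have h1 : ∑ x : Site d L, su2Deficit (U (x, i)) ≤ ∑ e : Edge d L, su2Deficit (U e) := by
    rw [Fintype.sum_prod_type]
    exact Finset.sum_le_sum fun x _ =>
      Finset.single_le_sum (f := fun j => su2Deficit (U (x, j))) (fun j _ => su2Deficit_nonneg _)
        (Finset.mem_univ i)
  have h2 : 0 ≤ (2 * g ^ 2)⁻¹ * ∑ p : Plaquette d L,
      su2Deficit (plaquetteHolonomy U p.1 p.2.1.1 p.2.1.2) :=
    mul_nonneg (inv_nonneg.2 (by positivity)) (Finset.sum_nonneg fun p _ => su2Deficit_nonneg _)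
  nlinarith [mul_le_mul_of_nonneg_left h1 (by positivity : (0 : ℝ) ≤ α ^ 2 / 2)]

/-- **Mean deficit of an edge in terms of the partition function**:
`(α²/2) · Lᵈ · E[t(U_{(x,i)})] ≤ E[H] ≤ log (1/Z)`. [folklore] -/
theorem card_mul_integral_su2Deficit_le (g α : ℝ) (i : Fin d) (x : Site d L) :
    α ^ 2 / 2 * (Fintype.card (Site d L) *
        ∫ U, su2Deficit (U (x, i)) ∂su2HiggsMeasure (d := d) L g α) ≤
      Real.log (((su2GibbsZ d L g α)⁻¹).toReal) := by
  haveI : IsProbabilityMeasure (su2HiggsMeasure (d := d) L g α) :=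
    isProbabilityMeasure_su2HiggsMeasure_holds (d := d) L g α
  set μ := su2HiggsMeasure (d := d) L g α with hμ
  have hmeas : ∀ z : Site d L, Measurable fun U : GaugeConfig d L SU2 => su2Deficit (U (z, i)) :=
    fun z => continuous_su2Deficit.measurable.comp (measurable_pi_apply _)
  have hint : ∀ z : Site d L, Integrable (fun U : GaugeConfig d L SU2 => su2Deficit (U (z, i))) μ :=
    fun z => Integrable.of_mem_Icc 0 4 (hmeas z).aemeasurable
      (ae_of_all _ fun U => ⟨su2Deficit_nonneg _, su2Deficit_le_four _⟩)
  have hHint : Integrable (su2HiggsH (d := d) (L := L) g α) μ :=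
    Integrable.of_mem_Icc 0 _ (measurable_su2HiggsH g α).aemeasurable
      (ae_of_all _ fun U => ⟨su2HiggsH_nonneg g α U, su2HiggsH_le g α U⟩)
  -- `E[(α²/2) ∑ₓ t] ≤ E[H]`
  have h1 : ∫ U, α ^ 2 / 2 * ∑ z : Site d L, su2Deficit (U (z, i)) ∂μ ≤ ∫ U, su2HiggsH g α U ∂μ :=
    integral_mono ((integrable_finsetSum _ fun z _ => hint z).const_mul _) hHint
      fun U => sum_su2Deficit_dir_le_su2HiggsH g α i U
  rw [integral_const_mul, integral_finsetSum _ fun z _ => hint z] at h1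
  have h2 : ∑ z : Site d L, ∫ U, su2Deficit (U (z, i)) ∂μ =
      Fintype.card (Site d L) * ∫ U, su2Deficit (U (x, i)) ∂μ := by
    rw [Finset.sum_congr rfl fun z _ => integral_su2Deficit_edge_eq g α i z x, Finset.sum_const,
      Finset.card_univ, nsmul_eq_mul]
  rw [h2] at h1
  exact h1.trans (integral_su2HiggsH_le_log g α)

/-! ### Quaternion norms: the deficit of products (plaquettes) -/

/-- `quatMatrix` is injective (the first row carries all four coordinates). [folklore] -/
theorem quatMatrix_injective : Function.Injective quatMatrix := by
  intro p q h
  have h00 := congrFun (congrFun h 0) 0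
  have h01 := congrFun (congrFun h 0) 1
  simp only [quatMatrix_apply_00, quatMatrix_apply_01, Complex.mk.injEq] at h00 h01
  ext <;> simp [h00.1, h00.2, h01.1, h01.2]

/-- `su2Quat` is multiplicative. [folklore] -/
theorem su2Quat_mul (U V : SU2) : su2Quat (U * V) = su2Quat U * su2Quat V := by
  apply quatMatrix_injective
  rw [quatMatrix_mul, quatMatrix_su2Quat, quatMatrix_su2Quat, quatMatrix_su2Quat, Submonoid.coe_mul]

/-- **The trace deficit is the squared quaternion distance to `1`**: `t(U) = ‖1 − q_U‖²`
(`‖1 − q‖² = 2 − 2 re q` for a unit quaternion, and `Re tr U = 2 re q_U`). This is Chatterjee's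
`‖I − U‖² = 4 − 2 Re Tr U` (5.2) transported to `S³`. [cite: Chatterjee2026YMHiggs, §5.3 (5.2)] -/
theorem su2Deficit_eq_norm_sub_sq (U : SU2) : su2Deficit U = ‖1 - su2Quat U‖ ^ 2 := by
  have htr : ((U : Matrix (Fin 2) (Fin 2) ℂ).trace).re = 2 * (su2Quat U).re := by
    rw [← quatMatrix_su2Quat U, trace_quatMatrix_re]
  have hn : ‖su2Quat U‖ ^ 2 = 1 := by rw [norm_su2Quat, one_pow]
  rw [sq_norm_eq_sum_sq] at hn
  rw [su2Deficit, htr, sq_norm_eq_sum_sq]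
  simp only [Quaternion.re_sub, Quaternion.re_one, Quaternion.imI_sub, Quaternion.imI_one,
    Quaternion.imJ_sub, Quaternion.imJ_one, Quaternion.imK_sub, Quaternion.imK_one, zero_sub,
    even_two, Even.neg_pow]
  nlinarith [hn]

/-- The deficit is inversion invariant: `t(U⁻¹) = t(U)` (`tr U* = conj tr U`). [folklore] -/
theorem su2Deficit_inv (U : SU2) : su2Deficit U⁻¹ = su2Deficit U := by
  unfold su2Deficit
  have h : ((U⁻¹ : SU2) : Matrix (Fin 2) (Fin 2) ℂ) = star (U : Matrix (Fin 2) (Fin 2) ℂ) := rfl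
  rw [h, Matrix.star_eq_conjTranspose, Matrix.trace_conjTranspose, Complex.star_def, Complex.conj_re]

/-- Quaternion distance to `1` is subadditive under products with a unit left factor:
`‖1 − p q‖ ≤ ‖1 − p‖ + ‖1 − q‖` (`1 − pq = (1 − p) + p(1 − q)`). [folklore] -/
theorem norm_one_sub_mul_le {p : ℍ} (hp : ‖p‖ = 1) (q : ℍ) : ‖1 - p * q‖ ≤ ‖1 - p‖ + ‖1 - q‖ := by
  have h : (1 : ℍ) - p * q = (1 - p) + p * (1 - q) := by noncomm_ring
  rw [h]
  refine (norm_add_le _ _).trans ?_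
  rw [norm_mul, hp, one_mul]

/-- Square-root deficit `s(U) = ‖1 − q_U‖ = √t(U)` is subadditive: `s(UV) ≤ s(U) + s(V)`.
[folklore] -/
theorem norm_one_sub_su2Quat_mul_le (U V : SU2) :
    ‖1 - su2Quat (U * V)‖ ≤ ‖1 - su2Quat U‖ + ‖1 - su2Quat V‖ := by
  rw [su2Quat_mul]
  exact norm_one_sub_mul_le (norm_su2Quat U) _

/-- `s(U⁻¹) = s(U)`. [folklore] -/
theorem norm_one_sub_su2Quat_inv (U : SU2) : ‖1 - su2Quat U⁻¹‖ = ‖1 - su2Quat U‖ := by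
  have h1 := su2Deficit_eq_norm_sub_sq U⁻¹
  have h2 := su2Deficit_eq_norm_sub_sq U
  rw [su2Deficit_inv] at h1
  have h3 : ‖1 - su2Quat U⁻¹‖ ^ 2 = ‖1 - su2Quat U‖ ^ 2 := by rw [← h1, ← h2]
  exact (sq_eq_sq₀ (norm_nonneg _) (norm_nonneg _)).1 h3

omit [NeZero L] in
/-- **Plaquette bound** (Chatterjee, proof of Lemma 5.5: "for any `U ∈ Σ'` and `p ∈ P`,
`‖I − U_p‖ ≤ 4α⁻¹`"): if the four edge variables of a plaquette have deficit `≤ η`, the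
plaquette holonomy has deficit `≤ 16 η`. [cite: Chatterjee2026YMHiggs, proof of Lemma 5.5] -/
theorem su2Deficit_plaquetteHolonomy_le {η : ℝ} (hη : 0 ≤ η) (U : GaugeConfig d L SU2)
    (hU : ∀ e : Edge d L, su2Deficit (U e) ≤ η) (x : Site d L) (i j : Fin d) :
    su2Deficit (plaquetteHolonomy U x i j) ≤ 16 * η := by
  have hs : ∀ e : Edge d L, ‖1 - su2Quat (U e)‖ ≤ Real.sqrt η := fun e => by
    rw [← Real.sqrt_sq (norm_nonneg _), ← su2Deficit_eq_norm_sub_sq]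
    exact Real.sqrt_le_sqrt (hU e)
  have key : ‖1 - su2Quat (plaquetteHolonomy U x i j)‖ ≤ 4 * Real.sqrt η := by
    unfold plaquetteHolonomy
    calc ‖1 - su2Quat (U (x, i) * U (x.shift i, j) * (U (x.shift j, i))⁻¹ * (U (x, j))⁻¹)‖
        ≤ ‖1 - su2Quat (U (x, i) * U (x.shift i, j) * (U (x.shift j, i))⁻¹)‖ +
            ‖1 - su2Quat (U (x, j))⁻¹‖ := norm_one_sub_su2Quat_mul_le _ _
      _ ≤ (‖1 - su2Quat (U (x, i) * U (x.shift i, j))‖ + ‖1 - su2Quat (U (x.shift j, i))⁻¹‖) +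
            ‖1 - su2Quat (U (x, j))⁻¹‖ := by gcongr; exact norm_one_sub_su2Quat_mul_le _ _
      _ ≤ ((‖1 - su2Quat (U (x, i))‖ + ‖1 - su2Quat (U (x.shift i, j))‖) +
            ‖1 - su2Quat (U (x.shift j, i))⁻¹‖) + ‖1 - su2Quat (U (x, j))⁻¹‖ := by
          gcongr; exact norm_one_sub_su2Quat_mul_le _ _
      _ ≤ ((Real.sqrt η + Real.sqrt η) + Real.sqrt η) + Real.sqrt η := by
          rw [norm_one_sub_su2Quat_inv, norm_one_sub_su2Quat_inv]
          gcongr <;> exact hs _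
      _ = 4 * Real.sqrt η := by ring
  rw [su2Deficit_eq_norm_sub_sq]
  calc ‖1 - su2Quat (plaquetteHolonomy U x i j)‖ ^ 2 ≤ (4 * Real.sqrt η) ^ 2 :=
        pow_le_pow_left₀ (norm_nonneg _) key 2
    _ = 16 * η := by rw [mul_pow, Real.sq_sqrt hη]; ring

/-! ### The good set `Σ'` and the lower bound on the partition function -/

/-- The trace-ball `T_η = {V ∈ SU(2) : t(V) ≤ η}`. [folklore] -/
def su2DeficitBall (η : ℝ) : Set SU2 := {V : SU2 | su2Deficit V ≤ η}

/-- `T_η` is closed, hence measurable. [folklore] -/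
theorem measurableSet_su2DeficitBall (η : ℝ) : MeasurableSet (su2DeficitBall η) :=
  (isClosed_le continuous_su2Deficit continuous_const).measurableSet

/-- Haar measure of the trace-ball: `Haar(T_η) ≥ η²/16` for `0 < η ≤ 1/4`
(`le_haarProbability_su2_two_sub_trace_le`). [folklore] -/
theorem le_haar_su2DeficitBall {η : ℝ} (hη0 : 0 < η) (hη : η ≤ 1 / 4) :
    ENNReal.ofReal (η ^ 2 / 16) ≤ haarProbability SU2 (su2DeficitBall η) :=
  le_haarProbability_su2_two_sub_trace_le hη0 hη

/-- Chatterjee's good set `Σ' = {U : t(U_e) ≤ η for all edges e}` (with `η = α⁻²`: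
"all `U` such that `‖I − U_e‖ ≤ α⁻¹` for all `e`"), a product of trace-balls.
[cite: Chatterjee2026YMHiggs, proof of Lemma 5.5 (the set Σ')] -/
def su2GoodSet (d L : ℕ) (η : ℝ) : Set (GaugeConfig d L SU2) :=
  Set.pi Set.univ fun _ : Edge d L => su2DeficitBall η

omit [NeZero L] in
/-- Membership in `Σ'`: every edge variable lies in the trace-ball. [folklore] -/
theorem mem_su2GoodSet {η : ℝ} {U : GaugeConfig d L SU2} :
    U ∈ su2GoodSet d L η ↔ ∀ e : Edge d L, su2Deficit (U e) ≤ η := by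
  simp [su2GoodSet, su2DeficitBall]

/-- `Σ'` is measurable (a finite product of closed sets). [folklore] -/
theorem measurableSet_su2GoodSet (η : ℝ) : MeasurableSet (su2GoodSet d L η) :=
  MeasurableSet.univ_pi fun _ => measurableSet_su2DeficitBall η

/-- **Product-Haar measure of `Σ'`**: `π(Σ') = Haar(T_η)^{|E|} ≥ (η²/16)^{|E|}` (Chatterjee: "the
normalized Haar measure of `Σ'` is `≥ (C₁α)^{−C₂Lᵈ}`"). [cite: Chatterjee2026YMHiggs, proof of Lemma 5.5] -/
theorem le_su2HaarPi_goodSet {η : ℝ} (hη0 : 0 < η) (hη : η ≤ 1 / 4) :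
    ENNReal.ofReal (η ^ 2 / 16) ^ Fintype.card (Edge d L) ≤ su2HaarPi d L (su2GoodSet d L η) := by
  rw [su2HaarPi, su2GoodSet, Measure.pi_pi, Finset.prod_const, Finset.card_univ]
  exact pow_le_pow_left' (le_haar_su2DeficitBall hη0 hη) _

/-- The sup of `H` on `Σ'`: `M(η) = (2g²)⁻¹ · 16η · |P| + (α²/2) · η · |E|`. [folklore] -/
def su2GoodSetSup (d L : ℕ) [NeZero L] (g α η : ℝ) : ℝ :=
  (2 * g ^ 2)⁻¹ * (16 * η * Fintype.card (Plaquette d L)) + α ^ 2 / 2 * (η * Fintype.card (Edge d L))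

/-- On `Σ'`, `H ≤ M(η)` (plaquette deficits `≤ 16η`, edge deficits `≤ η`). [folklore] -/
theorem su2HiggsH_le_of_mem_goodSet {g α η : ℝ} (hη : 0 ≤ η) {U : GaugeConfig d L SU2}
    (hU : U ∈ su2GoodSet d L η) : su2HiggsH g α U ≤ su2GoodSetSup d L g α η := by
  rw [mem_su2GoodSet] at hU
  unfold su2HiggsH su2GoodSetSup
  gcongr
  · calc ∑ p : Plaquette d L, su2Deficit (plaquetteHolonomy U p.1 p.2.1.1 p.2.1.2)
        ≤ ∑ _p : Plaquette d L, 16 * η :=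
          Finset.sum_le_sum fun p _ => su2Deficit_plaquetteHolonomy_le hη U hU _ _ _
      _ = 16 * η * Fintype.card (Plaquette d L) := by
          rw [Finset.sum_const, Finset.card_univ, nsmul_eq_mul]; ring
  · calc ∑ e : Edge d L, su2Deficit (U e) ≤ ∑ _e : Edge d L, η := Finset.sum_le_sum fun e _ => hU e
      _ = η * Fintype.card (Edge d L) := by
          rw [Finset.sum_const, Finset.card_univ, nsmul_eq_mul]; ring

/-- **Lower bound on the partition function**: `Z ≥ e^{−M(η)} (η²/16)^{|E|}` for `0 < η ≤ 1/4`
(Chatterjee: "`∫ p(U) ∏ dU_e ≥ e^{−C₁Lᵈ(αg)^{−2}} (C₂α)^{−C₃Lᵈ}`"). [cite: Chatterjee2026YMHiggs, proof of Lemma 5.5] -/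
theorem le_su2GibbsZ (g α : ℝ) {η : ℝ} (hη0 : 0 < η) (hη : η ≤ 1 / 4) :
    ENNReal.ofReal (Real.exp (-su2GoodSetSup d L g α η)) *
        ENNReal.ofReal (η ^ 2 / 16) ^ Fintype.card (Edge d L) ≤ su2GibbsZ d L g α := by
  rw [su2GibbsZ_eq_lintegral]
  calc ENNReal.ofReal (Real.exp (-su2GoodSetSup d L g α η)) *
        ENNReal.ofReal (η ^ 2 / 16) ^ Fintype.card (Edge d L)
      ≤ ENNReal.ofReal (Real.exp (-su2GoodSetSup d L g α η)) * su2HaarPi d L (su2GoodSet d L η) :=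
        mul_le_mul_right (le_su2HaarPi_goodSet hη0 hη) _
    _ = ∫⁻ _U in su2GoodSet d L η, ENNReal.ofReal (Real.exp (-su2GoodSetSup d L g α η))
          ∂su2HaarPi d L := by rw [setLIntegral_const]
    _ ≤ ∫⁻ U in su2GoodSet d L η, ENNReal.ofReal (Real.exp (-su2HiggsH g α U)) ∂su2HaarPi d L :=
        setLIntegral_mono' (measurableSet_su2GoodSet η) fun U hU =>
          ENNReal.ofReal_le_ofReal (Real.exp_le_exp.2
            (neg_le_neg (su2HiggsH_le_of_mem_goodSet hη0.le hU)))
    _ ≤ ∫⁻ U, ENNReal.ofReal (Real.exp (-su2HiggsH g α U)) ∂su2HaarPi d L :=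
        setLIntegral_le_lintegral _ _

/-- **Logarithmic form**: `log (1/Z) ≤ M(η) + |E| log (16/η²)`. [folklore] -/
theorem log_inv_su2GibbsZ_le (g α : ℝ) {η : ℝ} (hη0 : 0 < η) (hη : η ≤ 1 / 4) :
    Real.log (((su2GibbsZ d L g α)⁻¹).toReal) ≤
      su2GoodSetSup d L g α η + Fintype.card (Edge d L) * Real.log (16 / η ^ 2) := by
  set Z := su2GibbsZ d L g α with hZ
  set z₀ : ℝ := Real.exp (-su2GoodSetSup d L g α η) * (η ^ 2 / 16) ^ Fintype.card (Edge d L)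
    with hz₀
  have hη2 : 0 < η ^ 2 / 16 := by positivity
  have hz₀pos : 0 < z₀ := by positivity
  have hZge : ENNReal.ofReal z₀ ≤ Z := by
    rw [hz₀, ENNReal.ofReal_mul (Real.exp_pos _).le, ENNReal.ofReal_pow hη2.le]
    exact le_su2GibbsZ g α hη0 hη
  have hZ0 : Z ≠ 0 := su2GibbsZ_ne_zero g α
  have hZt : Z ≠ ∞ := su2GibbsZ_ne_top g α
  -- `(1/Z).toReal ≤ 1/z₀`
  have h1 : (Z⁻¹).toReal ≤ z₀⁻¹ := by
    have h := ENNReal.inv_le_inv.2 hZge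
    rw [← ENNReal.ofReal_inv_of_pos hz₀pos] at h
    have h' := ENNReal.toReal_mono ENNReal.ofReal_ne_top h
    rwa [ENNReal.toReal_ofReal (inv_nonneg.2 hz₀pos.le)] at h'
  have h2 : 0 < (Z⁻¹).toReal := ENNReal.toReal_pos (ENNReal.inv_ne_zero.2 hZt) (ENNReal.inv_ne_top.2 hZ0)
  calc Real.log ((Z⁻¹).toReal) ≤ Real.log (z₀⁻¹) := Real.log_le_log h2 h1
    _ = su2GoodSetSup d L g α η + Fintype.card (Edge d L) * Real.log (16 / η ^ 2) := by
        rw [Real.log_inv, hz₀, Real.log_mul (Real.exp_pos _).ne' (pow_pos hη2 _).ne', Real.log_exp,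
          Real.log_pow, show (16 : ℝ) / η ^ 2 = (η ^ 2 / 16)⁻¹ by rw [inv_div], Real.log_inv]
        ring

/-! ### Assembly: the key estimate -/

/-- Number of edges: `|E| = d · |Λ|`. [folklore] -/
theorem card_edge : (Fintype.card (Edge d L) : ℝ) = Fintype.card (Site d L) * d := by
  rw [Fintype.card_prod, Fintype.card_fin]; push_cast; ring

/-- Number of plaquettes: `|P| ≤ d² · |Λ|`. [folklore] -/
theorem card_plaquette_le : (Fintype.card (Plaquette d L) : ℝ) ≤ Fintype.card (Site d L) * d ^ 2 := by
  have h : Fintype.card {p : Fin d × Fin d // p.1 < p.2} ≤ d ^ 2 := by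
    refine (Fintype.card_subtype_le _).trans ?_
    rw [Fintype.card_prod, Fintype.card_fin, sq]
  have h2 : Fintype.card (Plaquette d L) ≤ Fintype.card (Site d L) * d ^ 2 := by
    rw [Fintype.card_prod]
    exact Nat.mul_le_mul_left _ h
  exact_mod_cast h2

/-- **Chatterjee's key estimate (Lemma 5.5) for the unitary-gauge `SU(2)` lattice
Yang–Mills–Higgs measure, with explicit constants.** For every dimension `d`, torus side `L ≥ 1`,
Higgs length `α ≥ 2`, every gauge coupling `g` (the tree's normalisation, `g_C = √2 g`; the junk
value `β = 0` at `g = 0` included) and every edge `(x, i)`,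

  `E_{su2HiggsMeasure}[2 − Re tr U_{(x,i)}] ≤ 16 d² / (g² α⁴) + (d + 2 d log (16 α⁴)) / α²`.

In Chatterjee's form (`‖I − V_e‖² = 2 (2 − Re tr V_e)`, `g_C² = 2g²`): `E‖I − V_e‖² ≤
C/(α⁴ g²) + C log α/α²` with `C` depending only on `d` — his hypothesis `α g ≤ 1` (used only to
merge terms) is not needed for this explicit form, and the bound is uniform in the volume `L`.
Proof exactly as in print: `H ≥ 0` gives `e^{H} ≥ 1`; `E[e^{H}] = 1/Z` (`lintegral_exp_su2HiggsH`);
Jensen (in place of the layer-cake bound) gives `E[H] ≤ log(1/Z)`; `Z ≥ e^{−sup_{Σ'} H} π(Σ')`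
with `Σ' = {t(U_e) ≤ α⁻² ∀e}`, `sup_{Σ'} H ≤ (2g²)⁻¹ 16α⁻²|P| + |E|/2` (plaquette bound
`t(U_p) ≤ 16 α⁻²` via quaternion norms) and `π(Σ') ≥ (α⁻⁴/16)^{|E|}` (`le_haar_su2DeficitBall`);
finally `H ≥ (α²/2) ∑ₓ t(U_{(x,i)})` and translation invariance (`integral_su2Deficit_edge_eq`)
give `(α²/2) Lᵈ E[t(U_{(x,i)})] ≤ E[H]`. [cite: Chatterjee2026YMHiggs, Lemma 5.5] -/
theorem integral_su2Deficit_le_keyEstimate {α : ℝ} (hα : 2 ≤ α) (g : ℝ) (x : Site d L) (i : Fin d) :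
    ∫ U, su2Deficit (U (x, i)) ∂su2HiggsMeasure (d := d) L g α ≤
      16 * d ^ 2 / (g ^ 2 * α ^ 4) + (d + 2 * d * Real.log (16 * α ^ 4)) / α ^ 2 := by
  set m := ∫ U, su2Deficit (U (x, i)) ∂su2HiggsMeasure (d := d) L g α with hm
  set S : ℝ := (Fintype.card (Site d L) : ℝ) with hSdef
  have hS : 0 < S := by rw [hSdef]; exact_mod_cast Fintype.card_pos
  have hα0 : 0 < α := lt_of_lt_of_le two_pos hα
  have hα2 : 0 < α ^ 2 := by positivity
  set η : ℝ := (α ^ 2)⁻¹ with hη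
  have hη0 : 0 < η := inv_pos.2 hα2
  have hη4 : η ≤ 1 / 4 := by
    rw [hη, one_div]
    exact inv_anti₀ (by norm_num) (by nlinarith)
  -- the two halves of the argument
  have h1 := card_mul_integral_su2Deficit_le (d := d) (L := L) g α i x
  have h2 := log_inv_su2GibbsZ_le (d := d) (L := L) g α hη0 hη4
  have key : α ^ 2 / 2 * (S * m) ≤ su2GoodSetSup d L g α η +
      Fintype.card (Edge d L) * Real.log (16 / η ^ 2) := h1.trans h2
  -- cardinalities
  have hlog : Real.log (16 / η ^ 2) = Real.log (16 * α ^ 4) := by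
    congr 1; rw [hη]; field_simp
  have hE := card_edge (d := d) (L := L)
  have hP := card_plaquette_le (d := d) (L := L)
  have hg2 : 0 ≤ (2 * g ^ 2)⁻¹ := inv_nonneg.2 (by positivity)
  have key' : α ^ 2 / 2 * (S * m) ≤ (2 * g ^ 2)⁻¹ * (16 * η * (S * d ^ 2)) +
      α ^ 2 / 2 * (η * (S * d)) + S * d * Real.log (16 * α ^ 4) := by
    refine key.trans ?_
    unfold su2GoodSetSup
    rw [hE, hlog, ← hSdef]
    have : (2 * g ^ 2)⁻¹ * (16 * η * (Fintype.card (Plaquette d L) : ℝ)) ≤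
        (2 * g ^ 2)⁻¹ * (16 * η * (S * d ^ 2)) := by
      gcongr
    linarith
  -- divide by `(α²/2) S > 0`
  have key'' : α ^ 2 / 2 * S * m ≤
      α ^ 2 / 2 * S * (16 * d ^ 2 / (g ^ 2 * α ^ 4) + (d + 2 * d * Real.log (16 * α ^ 4)) / α ^ 2) := by
    rw [mul_assoc, mul_assoc]
    refine key'.trans (le_of_eq ?_)
    rw [hη]
    rcases eq_or_ne g 0 with hg | hg
    · subst hg
      field_simp
      ring
    · field_simp
      ring
  exact le_of_mul_le_mul_left key'' (by positivity)

end Literature.MathematicalPhysics.QuantumFieldTheory
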